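import Summits.HubbardSuperconductivity.HubbardSuperconductivity.Theorems.CooperPairDMottWalkCooperPairDMottUniqueTwoHoleGroundState
import Summits.HubbardSuperconductivity.HubbardSuperconductivity.Theorems.CooperPairDMottWalkCooperPairDMottPairTrialCeilingTrialOperator
import Literature.MathematicalPhysics.QuantumLattice.SectorEigenvalueContinuation

/-!
# Route `CooperPairDMottWalk`, crux `CooperPairDMott` (stmt-HubbardSuperconductivity-1177):
# the Feshbach–Schur (Schur complement) reduction of the two-hole gap (stub `stub_twoHoleGapOrthogonal`)

Support file for the stub `stub_twoHoleGapOrthogonal` of the registered skeleton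
`Cruxes/CooperPairDMott/Lines/birth.lean` (clause (b) of the crux in spectral form: a vector `Ω` and
a level `E₁ > E(L²−2, 0)` with `Re⟨ψ, H ψ⟩ ≥ E₁ ‖ψ‖²` on the part of the two-hole sector orthogonal
to `Ω`). This file isolates the missing `L`-uniform engine as FINITE-DIMENSIONAL LINEAR ALGEBRA over
`ℂⁿ` with the pairing `star ψ ⬝ᵥ φ` (no Fock-space input):

* `gap_orthogonal_of_schur` — the Schur-complement (Feshbach) estimate. For a Hermitian `H`, an
  orthogonal projection `P` (Hermitian idempotent matrix; `Q = 1 − P`), a subspace `K`, a vector `Φ`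
  orthogonal to `Q K` and a level `E₁`: if `Q H Q ≥ E₁ + g` on `Q K` (`g > 0`) and
  `Re⟨p, H p⟩ ≥ E₁ ‖p‖² + ‖Q H p‖² / g` for `p ∈ P K` orthogonal to `Φ`, then `H ≥ E₁` on `Φ^⊥ ∩ K`
  (complete the square in `⟨ψ, Hψ⟩ = ⟨p,Hp⟩ + 2 Re⟨q, QHp⟩ + ⟨q,Hq⟩`);
* `gap_orthogonal_of_feshbach` — the same with the constants of second-order perturbation theory:
  complement gap `g` above `E₀`, in-band gap `δ` above `E₀` on `P K ⊖ Φ`, leakage `‖Q H p‖ ≤ β ‖p‖`,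
  and `β² ≤ (δ − ε)(g − ε)` give the level `E₁ = E₀ + ε`;
* `le_rayleigh_of_schur`, `le_minEnergyOn_of_schur`, `minEnergyOn_le_minEnergyOn_of_le` — the
  companion two-sided comparison of the true bottom `E₀ = minEnergyOn H K` with the bottom `E_M` of
  the band block: `E_M − β²/g ≤ E₀ ≤ E_M`;
* `le_rayleigh_of_schur_rank_one` — the block version with ONE trial vector `Φ` (Temple-type bound:
  a gap `g` on `Φ^⊥ ∩ K` above `E` and `Re⟨Φ,HΦ⟩ − E ≥ ‖HΦ − ⟨Φ,HΦ⟩Φ‖²/g` give `H ≥ E` on `K`);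
* `exists_gap_orthogonal_of_rayleigh_lt` — packaging into the shape of the stub's conclusion
  (`∃ Ω E₁, minEnergyOn H K < E₁ ∧ gap on Ω^⊥ ∩ K`).
The block architecture (symmetry blocks = plaquette momenta, one trial vector per block) built on
these is in the companion file `…TwoHoleGapBlocks`.

References: T. Kato, *Perturbation Theory for Linear Operators* (1966) §II.2; the Feshbach–Schur map
as in V. Bach, J. Fröhlich, I. M. Sigal, Adv. Math. 137 (1998) 299, §IV (finite-dimensional case);
G. Temple, Proc. R. Soc. A 119 (1928) 276 (Temple's inequality). All statements are [folklore];
no definition is introduced.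
-/

set_option linter.dupNamespace false -- the route namespace `HubbardSuperconductivity.HubbardSuperconductivity` is mandated

namespace Summit.HubbardSuperconductivity.HubbardSuperconductivity.Theorems.CooperPairDMottWalk

open Matrix
open scoped ComplexOrder
open Literature.MathematicalPhysics.QuantumLattice
open Literature.MathematicalPhysics.QuantumLattice.EigenvalueContinuation (re_star_dotProduct_self_nonneg)

section Generic

variable {ι : Type*} [Fintype ι]

/-! ### Elementary identities for the pairing `star ψ ⬝ᵥ φ` -/

/-- `Re⟨u, v⟩ = Re⟨v, u⟩`. [folklore] -/
theorem re_star_dotProduct_comm (u v : ι → ℂ) : (star u ⬝ᵥ v).re = (star v ⬝ᵥ u).re := by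
  rw [star_dotProduct u v, Complex.star_def, Complex.conj_re]

/-- `⟨H u, w⟩ = ⟨u, H w⟩` for Hermitian `H`. [folklore] -/
theorem star_mulVec_dotProduct_of_isHermitian {H : Matrix ι ι ℂ} (hH : H.IsHermitian)
    (u w : ι → ℂ) : star (H *ᵥ u) ⬝ᵥ w = star u ⬝ᵥ (H *ᵥ w) := by
  rw [star_mulVec, hH.eq, dotProduct_mulVec]

/-- `Re⟨u, H w⟩ = Re⟨w, H u⟩` for Hermitian `H`. [folklore] -/
theorem re_form_comm {H : Matrix ι ι ℂ} (hH : H.IsHermitian) (u w : ι → ℂ) :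
    (star u ⬝ᵥ (H *ᵥ w)).re = (star w ⬝ᵥ (H *ᵥ u)).re := by
  rw [← star_mulVec_dotProduct_of_isHermitian hH u w, re_star_dotProduct_comm]

/-- `‖u + v‖² = ‖u‖² + 2 Re⟨u, v⟩ + ‖v‖²`. [folklore] -/
theorem re_star_dotProduct_add_self (u v : ι → ℂ) :
    (star (u + v) ⬝ᵥ (u + v)).re =
      (star u ⬝ᵥ u).re + 2 * (star u ⬝ᵥ v).re + (star v ⬝ᵥ v).re := by
  rw [star_add, add_dotProduct, dotProduct_add, dotProduct_add, Complex.add_re, Complex.add_re,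
    Complex.add_re, re_star_dotProduct_comm v u]
  ring

/-- `Re⟨u + v, H (u + v)⟩ = Re⟨u, Hu⟩ + 2 Re⟨v, Hu⟩ + Re⟨v, Hv⟩` for Hermitian `H`. [folklore] -/
theorem re_form_add {H : Matrix ι ι ℂ} (hH : H.IsHermitian) (u v : ι → ℂ) :
    (star (u + v) ⬝ᵥ (H *ᵥ (u + v))).re =
      (star u ⬝ᵥ (H *ᵥ u)).re + 2 * (star v ⬝ᵥ (H *ᵥ u)).re + (star v ⬝ᵥ (H *ᵥ v)).re := by
  rw [mulVec_add, star_add, add_dotProduct, dotProduct_add, dotProduct_add, Complex.add_re,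
    Complex.add_re, Complex.add_re, re_form_comm hH u v]
  ring

/-- `‖g u + v‖² = g² ‖u‖² + 2 g Re⟨u, v⟩ + ‖v‖²` for real `g`. [folklore] -/
theorem re_star_dotProduct_real_smul_add_self (g : ℝ) (u v : ι → ℂ) :
    (star ((g : ℂ) • u + v) ⬝ᵥ ((g : ℂ) • u + v)).re =
      g ^ 2 * (star u ⬝ᵥ u).re + 2 * g * (star u ⬝ᵥ v).re + (star v ⬝ᵥ v).re := by
  rw [re_star_dotProduct_add_self, star_smul, Complex.star_def, Complex.conj_ofReal, smul_dotProduct,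
    smul_dotProduct, dotProduct_smul, smul_eq_mul, smul_eq_mul, smul_eq_mul, ← mul_assoc,
    Complex.re_ofReal_mul, ← Complex.ofReal_mul, Complex.re_ofReal_mul]
  ring

/-- **The completed square**: `0 ≤ g² ‖u‖² + 2 g Re⟨u, v⟩ + ‖v‖²`. [folklore] -/
theorem sq_add_two_mul_re_add_sq_nonneg (g : ℝ) (u v : ι → ℂ) :
    0 ≤ g ^ 2 * (star u ⬝ᵥ u).re + 2 * g * (star u ⬝ᵥ v).re + (star v ⬝ᵥ v).re := by
  rw [← re_star_dotProduct_real_smul_add_self]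
  exact re_star_dotProduct_self_nonneg _

/-- `Re⟨cu, H cu⟩ = |c|² Re⟨u, Hu⟩`: homogeneity of the energy form (with `H = 1`, of the norm form,
`one_mulVec`). [folklore] -/
theorem re_form_smul (H : Matrix ι ι ℂ) (c : ℂ) (u : ι → ℂ) :
    (star (c • u) ⬝ᵥ (H *ᵥ (c • u))).re = ‖c‖ ^ 2 * (star u ⬝ᵥ (H *ᵥ u)).re := by
  rw [mulVec_smul, star_smul, smul_dotProduct, dotProduct_smul, smul_smul, smul_eq_mul,
    Complex.star_def, Complex.conj_mul', ← Complex.ofReal_pow, Complex.re_ofReal_mul]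

/-! ### The Schur complement (Feshbach) estimate -/

/-- **The Schur-complement (Feshbach) estimate for a gap on `Φ^⊥`.** Let `H` be Hermitian, `P` an
orthogonal projection (a Hermitian idempotent matrix, `Q = 1 − P`), `K` a subspace, `Φ` a vector
orthogonal to `Q K` (e.g. `Φ ∈ range P`) and `E₁` a level. Suppose
(1) `Q H Q ≥ E₁ + g` on `Q K` with `g > 0`: `(E₁ + g) ‖q‖² ≤ Re⟨q, Hq⟩` for `q = ψ − Pψ`, `ψ ∈ K`;
(2) for `p = Pψ`, `ψ ∈ K`, orthogonal to `Φ`: `E₁ ‖p‖² + ‖Q H p‖² / g ≤ Re⟨p, Hp⟩`.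
Then `E₁ ‖ψ‖² ≤ Re⟨ψ, Hψ⟩` for every `ψ ∈ K` orthogonal to `Φ`. Proof: with `r = Q H p`,
`Re⟨ψ,Hψ⟩ = Re⟨p,Hp⟩ + 2 Re⟨q, r⟩ + Re⟨q,Hq⟩` and `2 Re⟨q, r⟩ ≥ −g ‖q‖² − ‖r‖²/g`
(`0 ≤ ‖g q + r‖²`). With the exact resolvent in place of `1/g` this is the Feshbach–Schur map
(Bach–Fröhlich–Sigal 1998 §IV; Kato §II.2); the form here is its standard one-sided consequence.
[folklore] -/
theorem gap_orthogonal_of_schur (H P : Matrix ι ι ℂ) (hH : H.IsHermitian) (hPh : P.IsHermitian)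
    (hPP : P * P = P) (K : Submodule ℂ (ι → ℂ)) (Φ : ι → ℂ) {E₁ g : ℝ} (hg : 0 < g)
    (hΦ : ∀ ψ ∈ K, star Φ ⬝ᵥ (ψ - P *ᵥ ψ) = 0)
    (hQ : ∀ ψ ∈ K, (E₁ + g) * (star (ψ - P *ᵥ ψ) ⬝ᵥ (ψ - P *ᵥ ψ)).re ≤
      (star (ψ - P *ᵥ ψ) ⬝ᵥ H *ᵥ (ψ - P *ᵥ ψ)).re)
    (hP : ∀ ψ ∈ K, star Φ ⬝ᵥ (P *ᵥ ψ) = 0 →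
      E₁ * (star (P *ᵥ ψ) ⬝ᵥ (P *ᵥ ψ)).re +
          (star (H *ᵥ (P *ᵥ ψ) - P *ᵥ (H *ᵥ (P *ᵥ ψ))) ⬝ᵥ
            (H *ᵥ (P *ᵥ ψ) - P *ᵥ (H *ᵥ (P *ᵥ ψ)))).re / g ≤
        (star (P *ᵥ ψ) ⬝ᵥ H *ᵥ (P *ᵥ ψ)).re) :
    ∀ ψ ∈ K, star Φ ⬝ᵥ ψ = 0 → E₁ * (star ψ ⬝ᵥ ψ).re ≤ (star ψ ⬝ᵥ H *ᵥ ψ).re := by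
  intro ψ hψ hΦψ
  have h1 := hQ ψ hψ
  set p : ι → ℂ := P *ᵥ ψ with hp
  set q : ι → ℂ := ψ - p with hq
  set r : ι → ℂ := H *ᵥ p - P *ᵥ (H *ᵥ p) with hr
  have hpq : ψ = p + q := by rw [hq, add_sub_cancel]
  -- `P` kills `q`, so `p ⊥ q` and `q ⊥ range P`
  have hPq : P *ᵥ q = 0 := by rw [hq, mulVec_sub, hp, mulVec_mulVec, hPP, sub_self]
  have hqP : ∀ w, star q ⬝ᵥ (P *ᵥ w) = 0 := fun w => by
    rw [← star_mulVec_dotProduct_of_isHermitian hPh, hPq, star_zero, zero_dotProduct]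
  have hpq0 : star p ⬝ᵥ q = 0 := by
    rw [hp, star_mulVec_dotProduct_of_isHermitian hPh, hPq, dotProduct_zero]
  -- `Φ ⊥ p`
  have hΦp : star Φ ⬝ᵥ p = 0 := by
    have h := hΦ ψ hψ
    rw [← hq] at h
    have : star Φ ⬝ᵥ ψ = star Φ ⬝ᵥ p + star Φ ⬝ᵥ q := by rw [← dotProduct_add, ← hpq]
    rw [hΦψ, h, add_zero] at this
    exact this.symm
  have h2 := hP ψ hψ hΦp
  -- Pythagoras
  have hnorm : (star ψ ⬝ᵥ ψ).re = (star p ⬝ᵥ p).re + (star q ⬝ᵥ q).re := by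
    conv_lhs => rw [hpq]
    rw [re_star_dotProduct_add_self, hpq0, Complex.zero_re, mul_zero, add_zero]
  -- the cross term only sees `r = Q H p`
  have hcross : (star q ⬝ᵥ (H *ᵥ p)).re = (star q ⬝ᵥ r).re := by
    rw [hr, dotProduct_sub, hqP, sub_zero]
  have henergy : (star ψ ⬝ᵥ (H *ᵥ ψ)).re =
      (star p ⬝ᵥ (H *ᵥ p)).re + 2 * (star q ⬝ᵥ r).re + (star q ⬝ᵥ (H *ᵥ q)).re := by
    conv_lhs => rw [hpq]
    rw [re_form_add hH, hcross]
  -- complete the square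
  have hsq' : 0 ≤ g * (star q ⬝ᵥ q).re + 2 * (star q ⬝ᵥ r).re + (star r ⬝ᵥ r).re / g := by
    have := div_nonneg (sq_add_two_mul_re_add_sq_nonneg g q r) hg.le
    calc (0 : ℝ) ≤ (g ^ 2 * (star q ⬝ᵥ q).re + 2 * g * (star q ⬝ᵥ r).re + (star r ⬝ᵥ r).re) / g :=
        this
      _ = _ := by field_simp
  rw [hnorm, henergy]
  rw [← hr] at h2
  nlinarith [h1, h2, hsq']

/-- **The Feshbach estimate with the constants of second-order perturbation theory.** With `H`,
`P`, `K`, `Φ` as in `gap_orthogonal_of_schur` and a reference level `E₀`: if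
(1) the complement block is gapped, `(E₀ + g) ‖q‖² ≤ Re⟨q, Hq⟩` for `q ∈ Q K`;
(2) the band block is gapped above `Φ`, `(E₀ + δ) ‖p‖² ≤ Re⟨p, Hp⟩` for `p ∈ P K` orthogonal to `Φ`;
(3) the leakage is small, `‖Q H p‖² ≤ β² ‖p‖²` for `p ∈ P K`;
and `ε < g`, `β² ≤ (δ − ε)(g − ε)`, then `(E₀ + ε) ‖ψ‖² ≤ Re⟨ψ, Hψ⟩` on `Φ^⊥ ∩ K`. (E.g.
`4β²/g ≤ δ/2` allows `ε = min (δ/4) (g/2)`.) Kato (1966) §II.2; the in-band quantities `δ`, `β²/g`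
are both of second order in the coupling, which is why the band block `P K` must be the DRESSED
pair band for this to be applicable. [folklore] -/
theorem gap_orthogonal_of_feshbach (H P : Matrix ι ι ℂ) (hH : H.IsHermitian) (hPh : P.IsHermitian)
    (hPP : P * P = P) (K : Submodule ℂ (ι → ℂ)) (Φ : ι → ℂ) {E₀ g δ β ε : ℝ}
    (hεg : ε < g) (hβ : β ^ 2 ≤ (δ - ε) * (g - ε))
    (hΦ : ∀ ψ ∈ K, star Φ ⬝ᵥ (ψ - P *ᵥ ψ) = 0)
    (hQ : ∀ ψ ∈ K, (E₀ + g) * (star (ψ - P *ᵥ ψ) ⬝ᵥ (ψ - P *ᵥ ψ)).re ≤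
      (star (ψ - P *ᵥ ψ) ⬝ᵥ H *ᵥ (ψ - P *ᵥ ψ)).re)
    (hband : ∀ ψ ∈ K, star Φ ⬝ᵥ (P *ᵥ ψ) = 0 →
      (E₀ + δ) * (star (P *ᵥ ψ) ⬝ᵥ (P *ᵥ ψ)).re ≤ (star (P *ᵥ ψ) ⬝ᵥ H *ᵥ (P *ᵥ ψ)).re)
    (hleak : ∀ ψ ∈ K,
      (star (H *ᵥ (P *ᵥ ψ) - P *ᵥ (H *ᵥ (P *ᵥ ψ))) ⬝ᵥ (H *ᵥ (P *ᵥ ψ) - P *ᵥ (H *ᵥ (P *ᵥ ψ)))).re ≤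
        β ^ 2 * (star (P *ᵥ ψ) ⬝ᵥ (P *ᵥ ψ)).re) :
    ∀ ψ ∈ K, star Φ ⬝ᵥ ψ = 0 → (E₀ + ε) * (star ψ ⬝ᵥ ψ).re ≤ (star ψ ⬝ᵥ H *ᵥ ψ).re := by
  have hg' : 0 < g - ε := sub_pos.2 hεg
  refine gap_orthogonal_of_schur H P hH hPh hPP K Φ hg' hΦ (fun ψ hψ => ?_) (fun ψ hψ hΦp => ?_)
  · have := hQ ψ hψ
    convert this using 2
    ring
  · have h2 := hband ψ hψ hΦp
    have h3 := hleak ψ hψ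
    have hpos := re_star_dotProduct_self_nonneg (P *ᵥ ψ)
    set a := (star (P *ᵥ ψ) ⬝ᵥ (P *ᵥ ψ)).re
    set c := (star (H *ᵥ (P *ᵥ ψ) - P *ᵥ (H *ᵥ (P *ᵥ ψ))) ⬝ᵥ
      (H *ᵥ (P *ᵥ ψ) - P *ᵥ (H *ᵥ (P *ᵥ ψ)))).re
    have hc : c / (g - ε) ≤ (δ - ε) * a := by
      rw [div_le_iff₀ hg']
      calc c ≤ β ^ 2 * a := h3
        _ ≤ (δ - ε) * (g - ε) * a := mul_le_mul_of_nonneg_right hβ hpos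
        _ = (δ - ε) * a * (g - ε) := by ring
    linarith

/-- **The Schur lower bound on the whole subspace** (`Φ = 0` in `gap_orthogonal_of_schur`): if
`Q H Q ≥ E + g` on `Q K` (`g > 0`) and `Re⟨p, Hp⟩ ≥ E ‖p‖² + ‖Q H p‖²/g` for all `p ∈ P K`, then
`H ≥ E` on `K`. [folklore] -/
theorem le_rayleigh_of_schur (H P : Matrix ι ι ℂ) (hH : H.IsHermitian) (hPh : P.IsHermitian)
    (hPP : P * P = P) (K : Submodule ℂ (ι → ℂ)) {E g : ℝ} (hg : 0 < g)
    (hQ : ∀ ψ ∈ K, (E + g) * (star (ψ - P *ᵥ ψ) ⬝ᵥ (ψ - P *ᵥ ψ)).re ≤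
      (star (ψ - P *ᵥ ψ) ⬝ᵥ H *ᵥ (ψ - P *ᵥ ψ)).re)
    (hP : ∀ ψ ∈ K,
      E * (star (P *ᵥ ψ) ⬝ᵥ (P *ᵥ ψ)).re +
          (star (H *ᵥ (P *ᵥ ψ) - P *ᵥ (H *ᵥ (P *ᵥ ψ))) ⬝ᵥ
            (H *ᵥ (P *ᵥ ψ) - P *ᵥ (H *ᵥ (P *ᵥ ψ)))).re / g ≤
        (star (P *ᵥ ψ) ⬝ᵥ H *ᵥ (P *ᵥ ψ)).re) :
    ∀ ψ ∈ K, E * (star ψ ⬝ᵥ ψ).re ≤ (star ψ ⬝ᵥ H *ᵥ ψ).re := fun ψ hψ =>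
  gap_orthogonal_of_schur H P hH hPh hPP K 0 hg (fun _ _ => by rw [star_zero, zero_dotProduct]) hQ
    (fun ψ hψ _ => hP ψ hψ) ψ hψ (by rw [star_zero, zero_dotProduct])

/-! ### Sector energies: the two-sided comparison `E_M − β²/g ≤ E₀ ≤ E_M` -/

/-- A quadratic-form lower bound on a non-trivial subspace bounds its sector energy from below:
if `E ‖ψ‖² ≤ Re⟨ψ, Hψ⟩` for all `ψ ∈ K` and `K ≠ ⊥`, then `E ≤ minEnergyOn H K`. [folklore] -/
theorem le_minEnergyOn_of_forall (H : Matrix ι ι ℂ) (K : Submodule ℂ (ι → ℂ)) (hK : K ≠ ⊥) {E : ℝ}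
    (h : ∀ ψ ∈ K, E * (star ψ ⬝ᵥ ψ).re ≤ (star ψ ⬝ᵥ H *ᵥ ψ).re) : E ≤ H.minEnergyOn K := by
  classical
  obtain ⟨w, hwK, hw0⟩ := Submodule.exists_mem_ne_zero_of_ne_bot hK
  obtain ⟨c, -, hc1⟩ := exists_smul_unit hw0
  refine le_csInf ⟨_, c • w, K.smul_mem c hwK, hc1, rfl⟩ ?_
  rintro _ ⟨ψ, hψ, hψ1, rfl⟩
  have := h ψ hψ
  rwa [hψ1, Complex.one_re, mul_one] at this

/-- **The variational upper bound `E₀ ≤ E_M`**: the sector energy is monotone under inclusion of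
subspaces, `minEnergyOn H K ≤ minEnergyOn H M` for `⊥ ≠ M ≤ K` and Hermitian `H`. [folklore] -/
theorem minEnergyOn_le_minEnergyOn_of_le {H : Matrix ι ι ℂ} (hH : H.IsHermitian)
    {M K : Submodule ℂ (ι → ℂ)} (hMK : M ≤ K) (hM : M ≠ ⊥) : H.minEnergyOn K ≤ H.minEnergyOn M := by
  classical
  obtain ⟨w, hwM, hw0⟩ := Submodule.exists_mem_ne_zero_of_ne_bot hM
  obtain ⟨c, -, hc1⟩ := exists_smul_unit hw0
  refine le_csInf ⟨_, c • w, M.smul_mem c hwM, hc1, rfl⟩ ?_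
  rintro _ ⟨ψ, hψ, hψ1, rfl⟩
  exact minEnergyOn_le_rayleigh_of_mem hH K (hMK hψ) hψ1

/-- **The Schur lower bound `E_M − β²/g ≤ E₀`.** If the band block is bounded below by `E_M`
(`E_M ‖p‖² ≤ Re⟨p, Hp⟩` on `P K`), the leakage by `β` (`‖Q H p‖² ≤ β² ‖p‖²`) and the complement
block by `E_M − β²/g + g` (`g > 0`), then `E_M − β²/g ≤ minEnergyOn H K` (`K ≠ ⊥`). Together with
`minEnergyOn_le_minEnergyOn_of_le` this locates the true bottom within `β²/g` below the band bottom,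
so the in-band gap hypothesis of `gap_orthogonal_of_feshbach` may be stated relative to either.
Kato (1966) §II.2. [folklore] -/
theorem le_minEnergyOn_of_schur (H P : Matrix ι ι ℂ) (hH : H.IsHermitian) (hPh : P.IsHermitian)
    (hPP : P * P = P) (K : Submodule ℂ (ι → ℂ)) (hK : K ≠ ⊥) {E_M g β : ℝ} (hg : 0 < g)
    (hband : ∀ ψ ∈ K, E_M * (star (P *ᵥ ψ) ⬝ᵥ (P *ᵥ ψ)).re ≤ (star (P *ᵥ ψ) ⬝ᵥ H *ᵥ (P *ᵥ ψ)).re)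
    (hleak : ∀ ψ ∈ K,
      (star (H *ᵥ (P *ᵥ ψ) - P *ᵥ (H *ᵥ (P *ᵥ ψ))) ⬝ᵥ (H *ᵥ (P *ᵥ ψ) - P *ᵥ (H *ᵥ (P *ᵥ ψ)))).re ≤
        β ^ 2 * (star (P *ᵥ ψ) ⬝ᵥ (P *ᵥ ψ)).re)
    (hQ : ∀ ψ ∈ K, (E_M - β ^ 2 / g + g) * (star (ψ - P *ᵥ ψ) ⬝ᵥ (ψ - P *ᵥ ψ)).re ≤
      (star (ψ - P *ᵥ ψ) ⬝ᵥ H *ᵥ (ψ - P *ᵥ ψ)).re) :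
    E_M - β ^ 2 / g ≤ H.minEnergyOn K := by
  refine le_minEnergyOn_of_forall H K hK (le_rayleigh_of_schur H P hH hPh hPP K hg hQ fun ψ hψ => ?_)
  have h2 := hband ψ hψ
  have h3 := hleak ψ hψ
  have hpos := re_star_dotProduct_self_nonneg (P *ᵥ ψ)
  set a := (star (P *ᵥ ψ) ⬝ᵥ (P *ᵥ ψ)).re
  set c := (star (H *ᵥ (P *ᵥ ψ) - P *ᵥ (H *ᵥ (P *ᵥ ψ))) ⬝ᵥ
    (H *ᵥ (P *ᵥ ψ) - P *ᵥ (H *ᵥ (P *ᵥ ψ)))).re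
  have hc : c / g ≤ β ^ 2 / g * a := by
    rw [div_mul_eq_mul_div, div_le_div_iff_of_pos_right hg]
    exact h3
  linarith

/-! ### One trial vector per block: the Temple-type Schur bound -/

/-- **Schur bound from ONE trial vector.** Let `H` be Hermitian, `K` a subspace, `Φ ∈ K` a unit
vector, `E` a level and `g > 0`. If `(E + g) ‖ψ‖² ≤ Re⟨ψ, Hψ⟩` for all `ψ ∈ K` orthogonal to `Φ`,
and the Rayleigh quotient `h = Re⟨Φ, HΦ⟩` and the leakage `ρ = ‖HΦ − ⟨Φ, HΦ⟩ Φ‖²` of `Φ` satisfy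
`E + ρ / g ≤ h`, then `E ‖ψ‖² ≤ Re⟨ψ, Hψ⟩` for ALL `ψ ∈ K`: the bottom of `H` on `K` is at least
`E` (the rank-one case `P = |Φ⟩⟨Φ|` of `le_rayleigh_of_schur`; optimising `E` gives the lower root
of the `2 × 2` secular equation `(h − E)(E + g + … ) = ρ`, Temple 1928). [folklore] -/
theorem le_rayleigh_of_schur_rank_one (H : Matrix ι ι ℂ) (hH : H.IsHermitian)
    (K : Submodule ℂ (ι → ℂ)) {Φ : ι → ℂ} (hΦK : Φ ∈ K) (hΦ1 : star Φ ⬝ᵥ Φ = 1) {E g : ℝ}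
    (hg : 0 < g)
    (hperp : ∀ ψ ∈ K, star Φ ⬝ᵥ ψ = 0 → (E + g) * (star ψ ⬝ᵥ ψ).re ≤ (star ψ ⬝ᵥ H *ᵥ ψ).re)
    (hΦ : E + (star (H *ᵥ Φ - (star Φ ⬝ᵥ H *ᵥ Φ) • Φ) ⬝ᵥ (H *ᵥ Φ - (star Φ ⬝ᵥ H *ᵥ Φ) • Φ)).re / g ≤
      (star Φ ⬝ᵥ H *ᵥ Φ).re) :
    ∀ ψ ∈ K, E * (star ψ ⬝ᵥ ψ).re ≤ (star ψ ⬝ᵥ H *ᵥ ψ).re := by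
  classical
  -- the rank-one projection `P = |Φ⟩⟨Φ|`
  set P : Matrix ι ι ℂ := vecMulVec Φ (star Φ) with hPdef
  have hPh : P.IsHermitian := isHermitian_vecMulVec_self Φ
  have hPP : P * P = P := vecMulVec_self_mul_self hΦ1
  have hPv : ∀ v, P *ᵥ v = (star Φ ⬝ᵥ v) • Φ := fun v => vecMulVec_self_mulVec Φ v
  refine le_rayleigh_of_schur H P hH hPh hPP K hg (fun ψ hψ => ?_) (fun ψ hψ => ?_)
  · -- `q = ψ − ⟨Φ,ψ⟩Φ ∈ K` is orthogonal to `Φ`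
    refine hperp _ (K.sub_mem hψ (by rw [hPv]; exact K.smul_mem _ hΦK)) ?_
    rw [hPv, dotProduct_sub, dotProduct_smul, hΦ1, smul_eq_mul, mul_one, sub_self]
  · -- `p = c Φ`, `c = ⟨Φ, ψ⟩`: everything scales by `|c|²`
    set c : ℂ := star Φ ⬝ᵥ ψ with hc
    have hp : P *ᵥ ψ = c • Φ := hPv ψ
    have hr : H *ᵥ (c • Φ) - P *ᵥ (H *ᵥ (c • Φ)) = c • (H *ᵥ Φ - (star Φ ⬝ᵥ H *ᵥ Φ) • Φ) := by
      rw [hPv, mulVec_smul, dotProduct_smul, smul_sub, smul_smul, smul_eq_mul]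
    have hn : ∀ v : ι → ℂ, (star (c • v) ⬝ᵥ (c • v)).re = ‖c‖ ^ 2 * (star v ⬝ᵥ v).re := fun v => by
      simpa only [one_mulVec] using re_form_smul (1 : Matrix ι ι ℂ) c v
    rw [hp, hr, re_form_smul, hn, hn, hΦ1, Complex.one_re, mul_one]
    have hpos : 0 ≤ ‖c‖ ^ 2 := sq_nonneg _
    have key := mul_le_mul_of_nonneg_left hΦ hpos
    calc E * ‖c‖ ^ 2 + ‖c‖ ^ 2 * (star (H *ᵥ Φ - (star Φ ⬝ᵥ H *ᵥ Φ) • Φ) ⬝ᵥ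
            (H *ᵥ Φ - (star Φ ⬝ᵥ H *ᵥ Φ) • Φ)).re / g
        = ‖c‖ ^ 2 * (E + (star (H *ᵥ Φ - (star Φ ⬝ᵥ H *ᵥ Φ) • Φ) ⬝ᵥ
            (H *ᵥ Φ - (star Φ ⬝ᵥ H *ᵥ Φ) • Φ)).re / g) := by ring
      _ ≤ ‖c‖ ^ 2 * (star Φ ⬝ᵥ H *ᵥ Φ).re := key

/-! ### From a gap above one trial vector to the conclusion of the stub -/

/-- **Packaging.** If some unit vector `Φ₀ ∈ K` has Rayleigh quotient `< E₁` and `H ≥ E₁` on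
`Ω^⊥ ∩ K`, then `∃ Ω E₁, minEnergyOn H K < E₁ ∧ (H ≥ E₁ on Ω^⊥ ∩ K)` — verbatim the shape of the
conclusion of `stub_twoHoleGapOrthogonal` at one `(U, b, k)` (variational principle
`minEnergyOn_le_rayleigh_of_mem`). [folklore] -/
theorem exists_gap_orthogonal_of_rayleigh_lt (H : Matrix ι ι ℂ) (hH : H.IsHermitian)
    (K : Submodule ℂ (ι → ℂ)) (Ω : ι → ℂ) {Φ₀ : ι → ℂ} (hΦ₀K : Φ₀ ∈ K) (hΦ₀1 : star Φ₀ ⬝ᵥ Φ₀ = 1)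
    {E₁ : ℝ} (hlt : (star Φ₀ ⬝ᵥ H *ᵥ Φ₀).re < E₁)
    (hgap : ∀ ψ ∈ K, star Ω ⬝ᵥ ψ = 0 → E₁ * (star ψ ⬝ᵥ ψ).re ≤ (star ψ ⬝ᵥ H *ᵥ ψ).re) :
    ∃ (Ω : ι → ℂ) (E₁ : ℝ), H.minEnergyOn K < E₁ ∧
      ∀ ψ ∈ K, star Ω ⬝ᵥ ψ = 0 → E₁ * (star ψ ⬝ᵥ ψ).re ≤ (star ψ ⬝ᵥ H *ᵥ ψ).re := by
  classical
  exact ⟨Ω, E₁, (minEnergyOn_le_rayleigh_of_mem hH K hΦ₀K hΦ₀1).trans_lt hlt, hgap⟩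

/-! ### Registered form -/

/-- **Registered sub-goal `twoHoleGap_schurComplement`** (closed form, as registered on the crux item):
the Schur-complement (Feshbach) estimate `gap_orthogonal_of_schur`. [folklore] -/
theorem twoHoleGap_schurComplement : ∀ {ι : Type} [Fintype ι] (H P : Matrix ι ι ℂ), H.IsHermitian → P.IsHermitian → P * P = P → ∀ (K : Submodule ℂ (ι → ℂ)) (Φ : ι → ℂ) {E₁ g : ℝ}, 0 < g → (∀ ψ ∈ K, star Φ ⬝ᵥ (ψ - P *ᵥ ψ) = 0) → (∀ ψ ∈ K, (E₁ + g) * (star (ψ - P *ᵥ ψ) ⬝ᵥ (ψ - P *ᵥ ψ)).re ≤ (star (ψ - P *ᵥ ψ) ⬝ᵥ H *ᵥ (ψ - P *ᵥ ψ)).re) → (∀ ψ ∈ K, star Φ ⬝ᵥ (P *ᵥ ψ) = 0 → E₁ * (star (P *ᵥ ψ) ⬝ᵥ (P *ᵥ ψ)).re + (star (H *ᵥ (P *ᵥ ψ) - P *ᵥ (H *ᵥ (P *ᵥ ψ))) ⬝ᵥ (H *ᵥ (P *ᵥ ψ) - P *ᵥ (H *ᵥ (P *ᵥ ψ)))).re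 / g ≤ (star (P *ᵥ ψ) ⬝ᵥ H *ᵥ (P *ᵥ ψ)).re) → ∀ ψ ∈ K, star Φ ⬝ᵥ ψ = 0 → E₁ * (star ψ ⬝ᵥ ψ).re ≤ (star ψ ⬝ᵥ H *ᵥ ψ).re :=
  fun H P hH hPh hPP K Φ _ _ hg hΦ hQ hP => gap_orthogonal_of_schur H P hH hPh hPP K Φ hg hΦ hQ hP

end Generic

end Summit.HubbardSuperconductivity.HubbardSuperconductivity.Theorems.CooperPairDMottWalk
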